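import Summits.NavierStokesRegularity.FluidComputer.PalasekTowerRegisterGlobal
import Summits.NavierStokesRegularity.NavierStokesRegularity.Theses.PalasekTowerBreakdown


/-! # BC3 skeleton for the crux `EpisodeInduction` (= `EpisodeInductionG`, register v2.3′ QUIET + GLOBAL ANCHOR)

Three registered stubs — the FIRST RUNG `HeredityAtOne` (the crux truncated to its first level
`k = 1`, i.e. the registered hand-over 1 → 2 at `N₁ ≈ 445 → N₂ ≈ 819`: the BC5 witness-of-weakness
target, to be certified by validated numerics + rigorous a-posteriori enclosure of ONE compaction
episode), and for the generic levels `k ≥ 2` (the asymptotic regime: `Re_k`, `DC1_k` increasing) the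
UPPER half `ContinuationEnvelope` (continuation of a stage to the next readout inside the next ceiling:
no premature blow-up, no overshoot) and the LOWER half `ReadoutFloors` (autonomous compaction: the
three floors of level `k+1` AT ITS READOUT for every such continuation) — and the kernel-checked
composition `EpisodeInductionG_of` (case split `k = 1` / `k ≥ 2`; the ANCHOR of the new stage is inherited from the old one
along the agreement on `[0, τ k] ⊇ [0, τ 0)`, `Schedule.AnchorGlobal.congr`), plus (v3) the ONE theorem concluding the ROUTE DECL BY NAME,
the hypothesis-free `EpisodeInduction_skeleton` (operator INBOX l.94/l.98: the checker registers a line only if the FIRST theorem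
concluding the crux is hypothesis-free; the composition `episode_composition` therefore concludes the crux's unfolded BODY). The three stub statements are byte-identical to v1 (planner g16,
481edd771cc84037) and definitionally the tree's `HeredityAt 1` / `ContinuationEnvelope` / `ReadoutFloors` of
`FluidComputer/PalasekTowerRegisterGlobalHeredity.lean` (p415576; not imported here only because its olean is not yet on the
farm). After the tenure split of `EpisodeInduction` into `HeredityAtOne` + `HeredityFromTwo` the first stub coincides with a
CHILD ITEM and the other two are the halves of `HeredityFromTwo` (`heredityFrom_two_of_envelope_floors`).
Cell `ns-blowup`, planner g16 (v1) / g17 (v2–v4). -/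

namespace Summit.NavierStokesRegularity.FluidComputer.PalasekTowerClayBridge.BirthEpisodeInductionG

open Set MeasureTheory Filter Topology Function Real
open scoped ENNReal ContDiff NNReal
open Literature.Analysis.FluidPDE

/-- the v2.3′ route margin: strain floors ∧ (GLOBAL anchor ∧ (rigidity ∧ core ledger)) -/
abbrev mG : Margins TowerRates.wide := Margins.routeG TowerRates.wide

/-- Stub R (FIRST RUNG = the crux at its first level only): every anchored registered stage at level `1`
of a pinned rigid quiet schedule extends to an anchored registered stage at level `2` — the hand-over `1 → 2`
(`N₁ = 256^{1.1} ≈ 445`, `N₂ ≈ 819`, window `c₅ log N₂ / A₁`). A finite truncation OF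
`EpisodeInductionG` (see `heredityAtOne_of_episodeInductionA`), in no regime where Clay (C) is known. -/
def HeredityAtOne : Prop :=
  ∀ S : Schedule TowerRates.wide, S.Pins 8 (6 / 5) → S.Rigid → S.Quiet →
  ∀ s : Stage 1 TowerRates.wide S mG 1, ∃ s' : Stage 1 TowerRates.wide S mG 2, s.Extends s'

/-- Stub A′ (UPPER ENVELOPE, generic levels): every registered stage at level `k ≥ 2` continues as a classical
finite-energy solution to the next readout `τ (k+1)` and stays inside the next ceiling `c₂ Y_{k+1}`
there. -/
def ContinuationEnvelope : Prop :=
  ∀ S : Schedule TowerRates.wide, S.Pins 8 (6 / 5) → S.Rigid → S.Quiet → ∀ k : ℕ, 2 ≤ k →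
  ∀ s : Stage 1 TowerRates.wide S mG k,
  ∃ (u : ℝ → EuclideanSpace ℝ (Fin 3) → EuclideanSpace ℝ (Fin 3))
    (p : ℝ → EuclideanSpace ℝ (Fin 3) → ℝ),
    IsClassicalNSSolutionOn (Icc 0 (S.τ (k + 1))) 1 S.f u p ∧
    (∀ t ∈ Icc 0 (S.τ k), u t = s.u t ∧ p t = s.p t) ∧
    (∃ C : ℝ≥0∞, C < ⊤ ∧ ∀ t ∈ Icc 0 (S.τ (k + 1)), ∫⁻ x, ‖u t x‖ₑ ^ 2 ≤ C) ∧
    (∀ t ∈ Icc 0 (S.τ (k + 1)), ∀ x, ‖u t x‖ ≤ S.c₂ * TowerRates.wide.Y (k + 1))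

/-- Stub B′ (FLOORS AT READOUT — autonomous compaction, generic levels `k ≥ 2`): every such continuation reaches, at
`τ (k+1)` and inside the ball, the velocity floor `c₁ Y_{k+1}`, the strain floor `c₁ A_{k+1}` and the
core ledger of level `k+1` (a loop of diameter `≤ 2/N_{k+1}` with circulation `≥ c₁ N_{k+1}^{β-2}`). -/
def ReadoutFloors : Prop :=
  ∀ S : Schedule TowerRates.wide, S.Pins 8 (6 / 5) → S.Rigid → S.Quiet → ∀ k : ℕ, 2 ≤ k →
  ∀ s : Stage 1 TowerRates.wide S mG k,
  ∀ (u : ℝ → EuclideanSpace ℝ (Fin 3) → EuclideanSpace ℝ (Fin 3))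
    (p : ℝ → EuclideanSpace ℝ (Fin 3) → ℝ),
    IsClassicalNSSolutionOn (Icc 0 (S.τ (k + 1))) 1 S.f u p →
    (∀ t ∈ Icc 0 (S.τ k), u t = s.u t ∧ p t = s.p t) →
    (∀ t ∈ Icc 0 (S.τ (k + 1)), ∀ x, ‖u t x‖ ≤ S.c₂ * TowerRates.wide.Y (k + 1)) →
    (∃ x, ‖x‖ ≤ S.radius ∧ S.c₁ * TowerRates.wide.Y (k + 1) ≤ ‖u (S.τ (k + 1)) x‖) ∧
    (∃ x, ‖x‖ ≤ S.radius ∧ S.c₁ * TowerRates.wide.A (k + 1) ≤ ‖fderiv ℝ (u (S.τ (k + 1))) x‖) ∧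
    (∃ (x : EuclideanSpace ℝ (Fin 3)) (γ : ℝ → EuclideanSpace ℝ (Fin 3)),
      ‖x‖ ≤ S.radius ∧ ContDiff ℝ 1 γ ∧ γ 0 = γ 1 ∧
      (∀ σ ∈ Icc (0 : ℝ) 1, γ σ ∈ Metric.closedBall x (1 / TowerRates.wide.N (k + 1))) ∧
      (∀ σ ∈ Icc (0 : ℝ) 1, ‖deriv γ σ‖ ≤ 8 * π / TowerRates.wide.N (k + 1)) ∧
      S.c₁ * TowerRates.wide.N (k + 1) ^ (TowerRates.wide.β - 2) ≤ circulation (u (S.τ (k + 1))) γ)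

/-- registered stub (BC5 first rung, plan-only): heredity at the first registered level. -/
theorem stub_heredity_at_one : HeredityAtOne := by
  sorry

/-- registered stub: the upper envelope (generic levels). -/
theorem stub_continuation_envelope : ContinuationEnvelope := by
  sorry

/-- registered stub: the readout floors. -/
theorem stub_readout_floors : ReadoutFloors := by
  sorry

/-- Under rigidity the growth window of level `k+1` is a nonnegative length. -/
theorem window_nonneg {S : Schedule TowerRates.wide} (h : S.Rigid) (k : ℕ) :
    0 ≤ S.c₅ * Real.log (TowerRates.wide.N (k + 1)) / TowerRates.wide.A k := by
  have h1 : 0 < S.c₅ := by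
    rw [h.c₅_eq]
    have hb := TowerRates.wide.one_lt_b
    have hβ := TowerRates.wide.two_lt_β
    positivity
  have h2 : 0 < Real.log (TowerRates.wide.N (k + 1)) := Real.log_pos (TowerRates.wide.one_lt_N _)
  have h3 : 0 < TowerRates.wide.A k := TowerRates.wide.A_pos k
  positivity

/-- The first rung IS a truncation of the crux (so a proof of the rung is a witness of weakness OF
`EpisodeInductionG`, not of something else). -/
theorem heredityAtOne_of_episodeInductionA (h : EpisodeInductionG) : HeredityAtOne :=
  fun S hP hR hQ s => h S hP hR hQ 1 le_rfl s

/-- **The composition (kernel-checked): first rung + (upper envelope + readout floors at the generic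
levels) ⇒ the BODY of K2G `EpisodeInductionG` spelled out (register v2.3′ QUIET + GLOBAL ANCHOR)** — stated against
the unfolded body so that the ONLY theorem of this file whose conclusion is the crux constant (by either of its
names) is the hypothesis-free `EpisodeInduction_skeleton` below (skeleton-checker convention, operator INBOX l.94/l.98). -/
theorem episode_composition :
    HeredityAtOne → ContinuationEnvelope → ReadoutFloors →
      ∀ S : Schedule TowerRates.wide, S.Pins 8 (6 / 5) → S.Rigid → S.Quiet → ∀ k : ℕ, 1 ≤ k →
        ∀ s : Stage 1 TowerRates.wide S mG k, ∃ s' : Stage 1 TowerRates.wide S mG (k + 1), s.Extends s' := by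
  intro hR hA hB S hP hRig hQ k hk s
  rcases Nat.lt_or_ge k 2 with hk2 | hk2
  · obtain rfl : k = 1 := by omega
    exact hR S hP hRig hQ s
  obtain ⟨u, p, hcl, hagree, henergy, hceil⟩ := hA S hP hRig hQ k hk2 s
  obtain ⟨hfloor, hstrain, hcore⟩ := hB S hP hRig hQ k hk2 s u p hcl hagree hceil
  have hm : (∀ j, j ≤ k → ∃ x, ‖x‖ ≤ S.radius ∧
      S.c₁ * TowerRates.wide.A j ≤ ‖fderiv ℝ (s.u (S.τ j)) x‖) ∧
      (S.AnchorGlobal s.u ∧ (S.Rigid ∧ CoreLedger TowerRates.wide S k s.u)) := s.margin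
  obtain ⟨hstrain_old, hanch, hrig, hcore_old⟩ := hm
  -- agreement at the old readout times
  have hag : ∀ j, j ≤ k → u (S.τ j) = s.u (S.τ j) := fun j hj =>
    (hagree (S.τ j) ⟨(S.τ_pos j).le, S.τ_mono hj⟩).1
  have hag' : ∀ t, t ∈ Icc 0 (S.τ k) → u t = s.u t := fun t ht => (hagree t ht).1
  refine ⟨{ u := u, p := p, classical := hcl, initial := ?_, energy := henergy, floor := ?_,
            ceiling := ?_, quiet := ?_, margin := ?_ }, fun t ht => hagree t ht⟩
  · -- initial
    rw [hag' 0 ⟨le_rfl, (S.τ_pos k).le⟩]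
    exact s.initial
  · -- floors
    intro j hj
    rcases Nat.lt_or_ge j (k + 1) with h | h
    · have hjk : j ≤ k := Nat.lt_succ_iff.mp h
      rw [hag j hjk]
      exact s.floor j hjk
    · have hj' : j = k + 1 := le_antisymm hj h
      subst hj'
      exact hfloor
  · -- ceilings
    intro j hj t ht x
    rcases Nat.lt_or_ge j (k + 1) with h | h
    · have hjk : j ≤ k := Nat.lt_succ_iff.mp h
      rw [hag' t ⟨ht.1, ht.2.trans (S.τ_mono hjk)⟩]
      exact s.ceiling j hjk t ht x
    · have hj' : j = k + 1 := le_antisymm hj h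
      subst hj'
      exact hceil t ht x
  · -- quiet
    intro j hj t ht x
    rcases Nat.lt_or_ge (j + 1) (k + 1) with h | h
    · have hjk : j + 1 ≤ k := Nat.lt_succ_iff.mp h
      have hw := window_nonneg hrig j
      rw [hag' t ⟨ht.1, by linarith [ht.2, S.τ_mono hjk]⟩]
      exact s.quiet j hjk t ht x
    · have hj' : j = k := by omega
      subst hj'
      have ht' : t ∈ Icc 0 (S.τ j) := ⟨ht.1, by have := hrig.window_eq j; linarith [ht.2]⟩
      rw [hag' t ht']
      exact s.ceiling j le_rfl t ht' x
  · -- margin: strain floors ∧ (anchor ∧ (rigidity ∧ core ledger)); the anchor is inherited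
    show (∀ j, j ≤ k + 1 → ∃ x, ‖x‖ ≤ S.radius ∧
      S.c₁ * TowerRates.wide.A j ≤ ‖fderiv ℝ (u (S.τ j)) x‖) ∧
      (S.AnchorGlobal u ∧ (S.Rigid ∧ CoreLedger TowerRates.wide S (k + 1) u))
    refine ⟨?_, hanch.congr (k := k) hag', hrig, ?_⟩
    · intro j hj
      rcases Nat.lt_or_ge j (k + 1) with h | h
      · have hjk : j ≤ k := Nat.lt_succ_iff.mp h
        rw [hag j hjk]
        exact hstrain_old j hjk
      · have hj' : j = k + 1 := le_antisymm hj h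
        subst hj'
        exact hstrain
    · intro j hj
      rcases Nat.lt_or_ge j (k + 1) with h | h
      · have hjk : j ≤ k := Nat.lt_succ_iff.mp h
        rw [hag j hjk]
        exact hcore_old j hjk
      · have hj' : j = k + 1 := le_antisymm hj h
        subst hj'
        exact hcore

/-- The hypothesis-free skeleton line the checker registers (valiant conjb-2 pattern): the crux from the three
stubs (carries the stubs' `sorry`s — decoration, not closure evidence). -/
theorem EpisodeInduction_skeleton :
    Summit.NavierStokesRegularity.NavierStokesRegularity.Theses.PalasekTowerBreakdown.EpisodeInduction :=
  episode_composition stub_heredity_at_one stub_continuation_envelope stub_readout_floors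

end Summit.NavierStokesRegularity.FluidComputer.PalasekTowerClayBridge.BirthEpisodeInductionG
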